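import Literature.Topology.FourManifolds.GluckTwistSimplyConnected
import Literature.Topology.FourManifolds.GluckTwistHomology
import Literature.Topology.FourManifolds.TorusCoordinates
import Literature.AlgebraicTopology.FundamentalGroup.VanKampenKernel
import Literature.AlgebraicTopology.FundamentalGroup.PuncturedPlane
import Literature.Topology.FourManifolds.ConnectedSumTransportProofs
import Mathlib.Topology.Instances.Shrink
import Mathlib.Analysis.Complex.Trigonometric
import HarnessLib

/-!
# Kervaire's lemma for 2-knots, proved; a Gluck twist is simply connected, proved; universe lift

Sibling file of `GluckTwist.lean` / `GluckTwistSimplyConnected.lean` in the decomposition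
(D-0014 provefact, XL) of `Literature.Topology.FourManifolds.nonempty_homeomorph_sphere_of_isGluckTwist` (`Σ_K ≃ₜ S⁴`, Gluck,
Trans. AMS 104 (1962), §17). `GluckTwistSimplyConnected.lean` reduced the `π₁` leaf
`Literature.Topology.FourManifolds.simplyConnectedSpace_of_isGluckTwist` (and the route fact `Literature.Topology.FourManifolds.gluck_simplyConnected`) to the
named fact `Literature.Topology.FourManifolds.TwoKnot.normalClosure_meridian_eq_top` (Kervaire, Bull. SMF 93 (1965), Ch. I,
Lemme 1.2: the group of a 2-knot is normally generated by a meridian). This file **proves** that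
named fact, and hence the leaf and the route fact:

* `Literature.TwoKnot.normalClosure_meridian_eq_top_holds : TwoKnot.normalClosure_meridian_eq_top`;
* `Literature.simplyConnectedSpace_of_isGluckTwist_holds : simplyConnectedSpace_of_isGluckTwist`
  (every model `IX`, every universe);
* `Literature.gluck_simplyConnected_holds : gluck_simplyConnected`;
* assembly: `Literature.Topology.FourManifolds.nonempty_homeomorph_sphere_of_isGluckTwist_of_homology` (the target fact from its
  three remaining leaves `H₂ = 0`, `SPC4.nonempty_homotopyEquiv_sphere_four_iff`, Freedman) and
  `Literature.Topology.FourManifolds.gluck_homeomorph_sphere_four_of_textbook_facts` (the universe-`0` route fact from textbook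
  homology facts, the homotopy-4-sphere characterisation and Freedman's theorem);
* universe lift: `Literature.Topology.FourManifolds.nonempty_homeomorph_sphere_of_isGluckTwist_of_univ_zero` (the target fact at
  universe `0` implies it at every universe) and hence
  `Literature.Topology.FourManifolds.nonempty_homeomorph_sphere_of_isGluckTwist_of_textbook_facts` (the target fact at **every**
  universe from the same universe-`0` textbook facts), removing the universe restriction of the
  `H₂` leaf proved in `GluckTwistHomology.lean`.

## Proof of Kervaire's lemma

Seifert–van Kampen in kernel form (`Literature.AlgebraicTopology.FundamentalGroup.VanKampen.fromPath_mem_of_homotopic_refl`, Hatcher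
Thm. 1.20, `Literature/AlgebraicTopology/FundamentalGroup/VanKampenKernel.lean`) for the open cover
`S⁴ = (S⁴ ∖ K(S²)) ∪ ν(S² × ℝ²)` (`ν` a tubular neighbourhood; its range is open by invariance of
domain, `TwoKnot.TubularNbhd.isOpen_range`), with `N` the normal closure of the meridian:
`S⁴` is simply connected (`simplyConnectedSpace_euclideanSphere`), so every loop of the knot
complement is null-homotopic in `S⁴`; `S⁴ ∖ K` and the intersection `ν(S² × (ℝ² ∖ 0))` are path
connected (`GluckTwistSimplyConnected.lean`); and every loop of the complement lying in the tube
is a power of the meridian (`TwoKnot.TubularNbhd.fromPath_mem_zpowers_meridian`): pulled back by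
the embedding `ν` and the identification `ℝ² = ℂ` it is a loop of `S² × (ℂ ∖ 0)`, whose class is a
power of the slice winding loop since `S²` is simply connected and `π₁(ℂ ∖ 0)` is generated by the
winding loop (`Literature/AlgebraicTopology/FundamentalGroup/PuncturedPlane.lean`, via the
covering `exp`), and the slice winding loop maps to the meridian `t ↦ ν (y, r (cos 2πt, sin 2πt))`.
This is Kervaire's argument (proof of Lemme 1.2, pp. 228–229) with general position replaced by
van Kampen.

## Universe lift

A Gluck twist `X : Type u` is `Small.{0}` (it is covered by the images of the `Type`-valued pieces
`S⁴ ∖ K` and `S² × ℝ²`), so `Shrink.{0} X : Type` is a homeomorphic copy (`Shrink.homeomorph`,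
Mathlib). The `C^∞` structure is transported along this homeomorphism — in general: for
`φ : M ≃ₜ N` and a charted space `M` over `H`, `Literature.Homeomorph.transportChartedSpace φ` is the
atlas `{φ.symm ≫ c}` on `N` (Mathlib's `ChartedSpace.comp` with the one-chart atlas `{φ.symm}`),
it is a `G`-atlas when the atlas of `M` is (`Literature.Topology.FourManifolds.Homeomorph.hasGroupoid_transportChartedSpace`:
the transition map of `φ.symm ≫ c`, `φ.symm ≫ c'` is that of `c`, `c'`), hence `C^n` when `M` is
(`Literature.Topology.FourManifolds.Homeomorph.isManifold_transportChartedSpace`), and `φ` becomes a diffeomorphism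
(`Literature.Topology.FourManifolds.Homeomorph.transportDiffeomorph`: read in the charts `c` and `φ.symm ≫ c`, both `φ` and
`φ.symm` are the identity of the chart target). Gluck twists are transported along
diffeomorphisms of boundaryless manifolds (`Literature.Topology.FourManifolds.IsGluckTwist.of_diffeomorph`, from
`IsOpenGluing.diffeomorph_comp_of_boundaryless`, `ConnectedSumTransportProofs.lean`), so
`Shrink.{0} X` is a Gluck twist along `K`, the universe-`0` fact applies, and `X ≃ₜ S⁴`.

## Other declarations

* `Literature.Topology.FourManifolds.FundamentalGroup.mapOfEq_fromPath_eq`: transport of loop classes along a continuous map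
  given pointwise (`f_* [β] = [δ]` when `δ = f ∘ β`), the cast-free interface to
  `FundamentalGroup.mapOfEq`;
* `Literature.Topology.FourManifolds.PlaneComplex.ofC`: the inverse of the tree's `Literature.toC : ℝ² → ℂ` (`TorusCoordinates.lean`),
  with the polar formulas `ofC (r e^{iθ}) = r • circlePoint θ` and
  `toC (r • circlePoint θ) = r e^{iθ}`;
* `Literature.Topology.FourManifolds.TwoKnot.TubularNbhd.tubeMap`: `S² × (ℂ ∖ 0) → S⁴ ∖ K`, `(x, z) ↦ ν (x, z)`;
* `Literature.Topology.FourManifolds.IsGluckTwist.small`: a Gluck twist in any universe is `Small.{0}`;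
* `Literature.Topology.FourManifolds.contDiffWithinAt_extend_comp_extend_symm`: `(c.extend I) ∘ (c.extend I).symm` is `C^n`
  within `range I` on the target (it is the identity there).

## References

* M. A. Kervaire, *Les nœuds de dimensions supérieures*, Bull. Soc. Math. France 93 (1965)
  225–271, Ch. I §1, Lemme 1.2, pp. 228–229 [KervaireBSMF1965].
* H. Gluck, *The embedding of two-spheres in the four-sphere*, Trans. Amer. Math. Soc. 104 (1962)
  308–333, §17 [GluckTAMS1962].
* A. Hatcher, *Algebraic Topology* (2002), Thm. 1.7, Thm. 1.20 [HatcherAT2002].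

## Design notes

* The declarations `FundamentalGroup.mapOfEq_fromPath_eq`, `Homeomorph.transportChartedSpace`, …
  live in `Literature.FundamentalGroup`, `Literature.Homeomorph` (no Mathlib namespace is touched); they are
  used by their names (dot notation does not find them).
* The transported charted-space structure is a `def`, not an instance (it depends on `φ`); it is
  installed with `letI` where needed, exactly as in `HomotopyS4CompactProofs.lean`. In the
  transport section the model with corners is called `I₀` (`I` denotes the unit interval here).
* No declaration in this file uses `sorry`; the `_holds` theorems and the assembly theorems depend
  only on the axioms `propext`, `Classical.choice`, `Quot.sound`.
-/

noncomputable section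

open Complex hiding I
open Set Function unitInterval
open scoped Topology Manifold ContDiff Real

namespace Literature.Topology.FourManifolds

/-- Local notation: `𝔼 n` is the model Euclidean space `EuclideanSpace ℝ (Fin n)`. -/
local notation "𝔼 " n:arg => EuclideanSpace ℝ (Fin n)

/-- Local notation: `𝕊 n` is the unit sphere in `EuclideanSpace ℝ (Fin (n + 1))`. -/
local notation "𝕊 " n:arg => (Metric.sphere (0 : EuclideanSpace ℝ (Fin (n + 1))) 1)

/-! ### Transport of loop classes along a continuous map -/

/-- If `δ = f ∘ β` pointwise for loops `β` at `a` and `δ` at `z = f a`, then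
`f_* [β] = [δ]` (as elements of `π₁(Z, z)`, via `FundamentalGroup.mapOfEq`). [folklore] -/
theorem FundamentalGroup.mapOfEq_fromPath_eq {A Z : Type*} [TopologicalSpace A]
    [TopologicalSpace Z] (f : C(A, Z)) {a : A} {z : Z} (h : f a = z) (β : Path a a)
    (δ : Path z z) (hpt : ∀ t, δ t = f (β t)) :
    FundamentalGroup.mapOfEq f h (FundamentalGroup.fromPath (Path.Homotopic.Quotient.mk β)) =
      FundamentalGroup.fromPath (Path.Homotopic.Quotient.mk δ) := by
  subst h
  have e : δ = β.map f.continuous := by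
    ext t
    exact hpt t
  rw [FundamentalGroup.mapOfEq_apply, Path.Homotopic.Quotient.cast_rfl_rfl, e,
    Path.Homotopic.Quotient.mk_map]

/-! ### The plane `ℝ²` and `ℂ` -/

namespace PlaneComplex

/-- `ℂ → ℝ²`, `z ↦ (re z, im z)`: the inverse of the tree's identification
`Literature.toC : ℝ² → ℂ`, `v ↦ v₀ + v₁ i` (`TorusCoordinates.lean`). [folklore] -/
def ofC (z : ℂ) : 𝔼 2 := WithLp.toLp 2 ![z.re, z.im]

/-- First coordinate of `ofC`. [folklore] -/
@[simp] theorem ofC_apply_zero (z : ℂ) : ofC z 0 = z.re := rfl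

/-- Second coordinate of `ofC`. [folklore] -/
@[simp] theorem ofC_apply_one (z : ℂ) : ofC z 1 = z.im := rfl

/-- `toC ∘ ofC = id`. [folklore] -/
theorem toC_ofC (z : ℂ) : toC (ofC z) = z := Complex.ext (by simp) (by simp)

/-- `ofC ∘ toC = id`. [folklore] -/
theorem ofC_toC (w : 𝔼 2) : ofC (toC w) = w := by
  ext i
  fin_cases i <;> simp

/-- `toC` is continuous (it is smooth, `contDiff_toC`). [folklore] -/
theorem continuous_toC : Continuous toC := contDiff_toC.continuous

/-- `ofC` is continuous. [folklore] -/
theorem continuous_ofC : Continuous ofC := by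
  unfold ofC
  refine (PiLp.continuous_toLp 2 _).comp (continuous_pi fun i => ?_)
  fin_cases i
  · simpa using Complex.continuous_re
  · simpa using Complex.continuous_im

/-- `toC` preserves non-vanishing. [folklore] -/
theorem toC_ne_zero {w : 𝔼 2} (hw : w ≠ 0) : toC w ≠ 0 := fun h => hw (by
  rw [← ofC_toC w, h]
  ext i
  fin_cases i <;> simp)

/-- `ofC` preserves non-vanishing. [folklore] -/
theorem ofC_ne_zero {z : ℂ} (hz : z ≠ 0) : ofC z ≠ 0 := fun h => hz (by
  rw [← toC_ofC z, h]
  exact Complex.ext (by simp) (by simp))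

/-- Polar formula: `ofC (r e^{iθ}) = r (cos θ, sin θ)`. [folklore] -/
theorem ofC_polar (r θ : ℝ) :
    ofC (r * exp (θ * Complex.I)) = r • ((circlePoint θ : 𝕊 1) : 𝔼 2) := by
  ext i
  fin_cases i
  · simp [exp_ofReal_mul_I_re, circlePoint_apply_zero]
  · simp [exp_ofReal_mul_I_im, circlePoint_apply_one]

/-- Polar formula: `toC (r (cos θ, sin θ)) = r e^{iθ}`. [folklore] -/
theorem toC_polar (r θ : ℝ) :
    toC (r • ((circlePoint θ : 𝕊 1) : 𝔼 2)) = r * exp (θ * Complex.I) := by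
  rw [← ofC_polar, toC_ofC]

end PlaneComplex

open PlaneComplex

/-! ### Kervaire's lemma for 2-knots -/

namespace TwoKnot.TubularNbhd

variable {K : TwoKnot} (ν : TwoKnot.TubularNbhd K)

/-- The tube map `S² × (ℂ ∖ 0) → S⁴ ∖ K(S²)`, `(x, z) ↦ ν (x, z)` (plane identified with `ℂ`);
it takes values in the knot complement by `TwoKnot.TubularNbhd.apply_mem_compl_range`. [folklore] -/
def tubeMap : C((𝕊 2) × Literature.AlgebraicTopology.FundamentalGroup.PuncturedPlane.CStar, K.complement) where
  toFun a := ⟨ν.toFun (a.1, ofC (a.2 : ℂ)), ν.apply_mem_compl_range a.1 (ofC_ne_zero a.2.2)⟩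
  continuous_toFun :=
    (ν.continuous.comp (continuous_fst.prodMk
      (continuous_ofC.comp (continuous_subtype_val.comp continuous_snd)))).subtype_mk _

/-- Values of the tube map. [folklore] -/
theorem tubeMap_apply_coe (a : (𝕊 2) × Literature.AlgebraicTopology.FundamentalGroup.PuncturedPlane.CStar) :
    (ν.tubeMap a : 𝕊 4) = ν.toFun (a.1, ofC (a.2 : ℂ)) := rfl

/-- The tube map sends `(y, r)` to the base point `ν (y, (r, 0))` of the meridian. [folklore] -/
theorem tubeMap_base (y : 𝕊 2) {r : ℝ} (hr : 0 < r) :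
    ν.tubeMap (y, Literature.AlgebraicTopology.FundamentalGroup.PuncturedPlane.bpt r hr) = ν.fibrePt y hr.ne' 0 := by
  apply Subtype.ext
  rw [tubeMap_apply_coe, coe_fibrePt, Literature.AlgebraicTopology.FundamentalGroup.PuncturedPlane.bpt_coe]
  congr 2
  rw [← ofC_polar r 0]
  simp

/-- The meridian is the image of the slice winding loop under the tube map. [folklore] -/
theorem meridian_eq_tubeMap (y : 𝕊 2) {r : ℝ} (hr : 0 < r) (t : I) :
    ν.meridian y hr t = ν.tubeMap (Literature.AlgebraicTopology.FundamentalGroup.PuncturedPlane.sliceWindingLoop y r hr t) := by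
  apply Subtype.ext
  rw [meridian_apply, coe_fibrePt, tubeMap_apply_coe, Literature.AlgebraicTopology.FundamentalGroup.PuncturedPlane.sliceWindingLoop_apply,
    Literature.AlgebraicTopology.FundamentalGroup.PuncturedPlane.windingLoop_apply_coe, ofC_polar]
  simp

/-- **Loops in the punctured tube are powers of the meridian.** Every loop of `S⁴ ∖ K(S²)` at the
base point `ν (y, (r, 0))` lying in the tubular neighbourhood `ν(S² × ℝ²)` has its class in the
cyclic subgroup generated by the meridian (`S² × (ℝ² ∖ 0) ≃ S² × (ℂ ∖ 0)` has
`π₁ ≅ π₁(ℂ ∖ 0) = ⟨winding loop⟩`, `S²` being simply connected). [folklore] -/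
theorem fromPath_mem_zpowers_meridian (y : 𝕊 2) {r : ℝ} (hr : 0 < r)
    (δ : Path (ν.fibrePt y hr.ne' 0) (ν.fibrePt y hr.ne' 0))
    (hδ : ∀ t, (δ t : 𝕊 4) ∈ range ν.toFun) :
    FundamentalGroup.fromPath (Path.Homotopic.Quotient.mk δ) ∈
      Subgroup.zpowers (FundamentalGroup.fromPath
        (Path.Homotopic.Quotient.mk (ν.meridian y hr))) := by
  haveI : SimplyConnectedSpace (𝕊 2) := simplyConnectedSpace_euclideanSphere (n := 2) le_rfl
  -- pull the loop back to `S² × ℝ²` through the embedding `ν`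
  let eν := ν.isSmoothEmbedding.isEmbedding.toHomeomorph
  let q : I → (𝕊 2) × 𝔼 2 := fun t => eν.symm ⟨(δ t : 𝕊 4), hδ t⟩
  have hq : Continuous q :=
    eν.symm.continuous.comp ((continuous_subtype_val.comp δ.continuous).subtype_mk _)
  have hνq : ∀ t, ν.toFun (q t) = δ t := fun t => by
    have h := congrArg Subtype.val (eν.apply_symm_apply ⟨(δ t : 𝕊 4), hδ t⟩)
    rwa [Topology.IsEmbedding.toHomeomorph_apply_coe] at h
  have hq2 : ∀ t, (q t).2 ≠ 0 := fun t h0 => (δ t).2 ⟨(q t).1, by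
    rw [← ν.apply_zero, ← h0, Prod.mk.eta, hνq t]⟩
  have hbase : ∀ t, (δ t : 𝕊 4) = ν.toFun (y, r • ((circlePoint 0 : 𝕊 1) : 𝔼 2)) →
      q t = (y, r • ((circlePoint 0 : 𝕊 1) : 𝔼 2)) := fun t ht => by
    change eν.symm ⟨(δ t : 𝕊 4), hδ t⟩ = _
    have : (⟨(δ t : 𝕊 4), hδ t⟩ : range ν.toFun) =
        ⟨ν.toFun (y, r • ((circlePoint 0 : 𝕊 1) : 𝔼 2)), ⟨_, rfl⟩⟩ := Subtype.ext ht
    rw [this]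
    exact Topology.IsEmbedding.toHomeomorph_symm_apply _ _
  have hq0 : q 0 = (y, r • ((circlePoint 0 : 𝕊 1) : 𝔼 2)) :=
    hbase 0 (by rw [δ.source]; rfl)
  have hq1 : q 1 = (y, r • ((circlePoint 0 : 𝕊 1) : 𝔼 2)) :=
    hbase 1 (by rw [δ.target]; rfl)
  -- the loop in `S² × (ℂ ∖ 0)`
  let b : (𝕊 2) × Literature.AlgebraicTopology.FundamentalGroup.PuncturedPlane.CStar := (y, Literature.AlgebraicTopology.FundamentalGroup.PuncturedPlane.bpt r hr)
  let δA : Path b b :=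
    { toFun := fun t => ((q t).1, ⟨toC (q t).2, toC_ne_zero (hq2 t)⟩)
      continuous_toFun := (continuous_fst.comp hq).prodMk
        ((continuous_toC.comp (continuous_snd.comp hq)).subtype_mk _)
      source' := by
        refine Prod.ext ?_ (Subtype.ext ?_)
        · change (q 0).1 = y
          rw [hq0]
        · change toC (q 0).2 = (r : ℂ)
          rw [hq0, toC_polar]
          simp
      target' := by
        refine Prod.ext ?_ (Subtype.ext ?_)
        · change (q 1).1 = y
          rw [hq1]
        · change toC (q 1).2 = (r : ℂ)
          rw [hq1, toC_polar]
          simp }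
  have hδA : ∀ t, δ t = ν.tubeMap (δA t) := fun t => by
    apply Subtype.ext
    change (δ t : 𝕊 4) = ν.toFun ((q t).1, ofC (toC (q t).2))
    rw [ofC_toC, Prod.mk.eta, hνq]
  have hb : ν.tubeMap b = ν.fibrePt y hr.ne' 0 := ν.tubeMap_base y hr
  have e1 := FundamentalGroup.mapOfEq_fromPath_eq ν.tubeMap hb δA δ hδA
  have e2 := FundamentalGroup.mapOfEq_fromPath_eq ν.tubeMap hb
    (Literature.AlgebraicTopology.FundamentalGroup.PuncturedPlane.sliceWindingLoop y r hr) (ν.meridian y hr) (ν.meridian_eq_tubeMap y hr)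
  obtain ⟨k, hk⟩ := Subgroup.mem_zpowers_iff.1
    (Literature.AlgebraicTopology.FundamentalGroup.PuncturedPlane.fromPath_mem_zpowers_slice y r hr δA)
  rw [← e1, ← hk, map_zpow, e2]
  exact Subgroup.zpow_mem _ (Subgroup.mem_zpowers _) k

end TwoKnot.TubularNbhd

/-- **Kervaire's lemma, proved** (Kervaire, Bull. SMF 93 (1965), Ch. I, Lemme 1.2, pp. 228–229,
in the vendored specialisation `TwoKnot.normalClosure_meridian_eq_top`: the group
`π₁(S⁴ ∖ K(S²), x₀)` of a smooth 2-knot is the normal closure of a meridian). Proof: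
Seifert–van Kampen in kernel form (`VanKampen.fromPath_mem_of_homotopic_refl`, Hatcher Thm. 1.20)
for `S⁴ = (S⁴ ∖ K) ∪ ν(S² × ℝ²)`: `S⁴` is simply connected (`simplyConnectedSpace_euclideanSphere`),
the intersection `ν(S² × (ℝ² ∖ 0))` is path connected, and its loops are powers of the meridian
(`TwoKnot.TubularNbhd.fromPath_mem_zpowers_meridian`: `π₁(ℂ ∖ 0)` is generated by the winding
loop, via the covering `exp`). [cite: KervaireBSMF1965, Ch. I, Lemme 1.2]
[cite: HatcherAT2002, Thm. 1.20] -/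
theorem TwoKnot.normalClosure_meridian_eq_top_holds : TwoKnot.normalClosure_meridian_eq_top := by
  intro K ν y r hr
  haveI : SimplyConnectedSpace (𝕊 4) := simplyConnectedSpace_euclideanSphere (n := 4) (by norm_num)
  let a₀ : K.complement := ν.fibrePt y hr.ne' 0
  let N : Subgroup (FundamentalGroup K.complement a₀) := Subgroup.normalClosure
    {FundamentalGroup.fromPath (Path.Homotopic.Quotient.mk (ν.meridian y hr))}
  haveI hN : N.Normal := Subgroup.normalClosure_normal
  change N = ⊤
  rw [eq_top_iff]
  rintro g -
  obtain ⟨γ, hγ⟩ := Path.Homotopic.Quotient.mk_surjective (FundamentalGroup.toPath g)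
  rw [show g = FundamentalGroup.fromPath (Path.Homotopic.Quotient.mk γ) from hγ.symm]
  have hUo : IsOpen (K.complement : Set (𝕊 4)) := K.complement.isOpen
  have hUT : (K.complement : Set (𝕊 4)) ∪ range ν.toFun = univ := by
    refine eq_univ_of_forall fun a => ?_
    by_cases ha : a ∈ range K
    · exact Or.inr (ν.range_subset_range ha)
    · exact Or.inl ha
  have hUpc : IsPathConnected (K.complement : Set (𝕊 4)) := ν.isPathConnected_compl_range
  have hmeet : IsPathConnected ((K.complement : Set (𝕊 4)) ∩ range ν.toFun) := by
    change IsPathConnected ((range K)ᶜ ∩ range ν.toFun)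
    rw [ν.compl_range_inter_range]
    exact TwoKnot.TubularNbhd.isPathConnected_compl_zeroSection.image ν.continuous
  have hxT : (a₀ : 𝕊 4) ∈ range ν.toFun := ⟨_, rfl⟩
  have hnull : (γ.map continuous_subtype_val).Homotopic (Path.refl (a₀ : 𝕊 4)) :=
    SimplyConnectedSpace.paths_homotopic _ _
  refine Literature.AlgebraicTopology.FundamentalGroup.VanKampen.fromPath_mem_of_homotopic_refl (Y := 𝕊 4) (U := (K.complement : Set (𝕊 4)))
    (T := range ν.toFun) hUo ν.isOpen_range hUT hUpc hmeet a₀.2 hxT N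
    (fun δ hδ => ?_) γ hnull
  exact Subgroup.zpowers_le.2 (Subgroup.subset_normalClosure (mem_singleton _))
    (ν.fromPath_mem_zpowers_meridian y hr δ hδ)

/-! ### Consequences: the `π₁` leaf of the Gluck twist decomposition, proved -/

section GluckTwist

variable {EX HX : Type*} [NormedAddCommGroup EX] [NormedSpace ℝ EX] [TopologicalSpace HX]
  {IX : ModelWithCorners ℝ EX HX} {X : Type*} [TopologicalSpace X] [ChartedSpace HX X]
  {K : TwoKnot}

/-- **A Gluck twist is simply connected, proved** (Gluck, Trans. AMS 104 (1962), §17): the named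
fact `simplyConnectedSpace_of_isGluckTwist` of `GluckTwist.lean` holds, by
`simplyConnectedSpace_of_isGluckTwist_of` (`GluckTwistSimplyConnected.lean`) and Kervaire's lemma
`TwoKnot.normalClosure_meridian_eq_top_holds`. [cite: GluckTAMS1962, §17] -/
theorem simplyConnectedSpace_of_isGluckTwist_holds :
    simplyConnectedSpace_of_isGluckTwist (IX := IX) (X := X) (K := K) :=
  simplyConnectedSpace_of_isGluckTwist_of TwoKnot.normalClosure_meridian_eq_top_holds

omit K in
/-- **The route fact `gluck_simplyConnected` (`GluckTwistFacts.lean`), proved.**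
[cite: GluckTAMS1962, §17] -/
theorem gluck_simplyConnected_holds : gluck_simplyConnected :=
  gluck_simplyConnected_of TwoKnot.normalClosure_meridian_eq_top_holds

end GluckTwist

/-! ### Assembly: the target fact from the remaining leaves -/

section Assembly

universe u

/-- **The target fact from its three remaining leaves.** With compactness
(`IsGluckTwist.compactSpace_holds`, `GluckTwistProofs.lean`) and simple connectivity
(`simplyConnectedSpace_of_isGluckTwist_holds`) now proved, the target fact
`nonempty_homeomorph_sphere_of_isGluckTwist` (`Σ_K ≃ₜ S⁴`) at universe `u` follows from the
`H₂ = 0` leaf (`isZero_singularHomologyZ_two_of_isGluckTwist`, Gluck 1962, §17; proved at universe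
`0` from textbook homology facts in `GluckTwistHomology.lean`), the `π₁`/`H₂` characterisation of
homotopy 4-spheres (`SPC4.nonempty_homotopyEquiv_sphere_four_iff`) and Freedman's theorem
(`SPC4.nonempty_homeomorph_sphere_four`, Freedman 1982, Thm. 1.6), by
`nonempty_homeomorph_sphere_of_isGluckTwist_of_facts` (`GluckTwistHomotopySphere.lean`).
[cite: GluckTAMS1962, §17] [cite: FreedmanJDG1982, Thm. 1.6] -/
theorem nonempty_homeomorph_sphere_of_isGluckTwist_of_homology {K : TwoKnot}
    (hH : isZero_singularHomologyZ_two_of_isGluckTwist.{u} (K := K))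
    (hS10 : FourManifolds.nonempty_homotopyEquiv_sphere_four_iff.{u})
    (hF : FourManifolds.nonempty_homeomorph_sphere_four.{u}) :
    nonempty_homeomorph_sphere_of_isGluckTwist.{u} (K := K) :=
  nonempty_homeomorph_sphere_of_isGluckTwist_of_facts
    (fun {_} _ _ => IsGluckTwist.compactSpace_holds)
    (fun {_} _ _ => simplyConnectedSpace_of_isGluckTwist_holds) hH hS10 hF

/-- **The route fact `gluck_homeomorph_sphere_four` from textbook facts** (universe `0`): after this
file, the Gluck-specific input of `gluck_homeomorph_sphere_four_of_mayerVietoris`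
(`GluckTwistHomology.lean`) is proved, and the route fact rests only on excision and Mayer–Vietoris
exactness for singular homology, the homology of spheres, `H̃_*(Sⁿ ∖ h(Sᵏ))`
(Hatcher Prop. 2B.1(b)), the `π₁`/`H₂` characterisation of homotopy 4-spheres and Freedman's
theorem.
[cite: GluckTAMS1962, §17] [cite: FreedmanJDG1982, Thm. 1.6] -/
theorem gluck_homeomorph_sphere_four_of_textbook_facts
    (hexc : ∀ (T : Type) [TopologicalSpace T],
      Literature.AlgebraicTopology.SingularHomology.relativeSingularHomology.isIso_map_of_interior_union_interior ℤ ℤ T)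
    (h₂ : ∀ (T : Type) [TopologicalSpace T] (U V : Set T), Literature.AlgebraicTopology.SingularHomology.mayerVietoris.exact₂ ℤ ℤ U V)
    (h₃ : ∀ (T : Type) [TopologicalSpace T] (U V : Set T), Literature.AlgebraicTopology.SingularHomology.mayerVietoris.exact₃ ℤ ℤ U V)
    (hS : Literature.AlgebraicTopology.SingularHomology.isZero_singularHomology_sphere ℤ ℤ)
    (h2B1 : isZero_singularHomology_sphere_compl_sphere)
    (hS10 : FourManifolds.nonempty_homotopyEquiv_sphere_four_iff.{0})
    (hF : FourManifolds.nonempty_homeomorph_sphere_four.{0}) : gluck_homeomorph_sphere_four :=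
  gluck_homeomorph_sphere_four_of_mayerVietoris
    (fun _ {_} _ _ => simplyConnectedSpace_of_isGluckTwist_holds) hexc h₂ h₃ hS h2B1 hS10 hF

end Assembly

/-! ### Transport of charted-space and manifold structures along a homeomorphism -/

section TransportChartedSpace

variable {H : Type*} [TopologicalSpace H] {M : Type*} [TopologicalSpace M] [ChartedSpace H M]
  {N : Type*} [TopologicalSpace N]

/-- The charted space structure on `N` **transported** along a homeomorphism `φ : M ≃ₜ N`: the
charts are `φ.symm ≫ c` for the charts `c` of `M` (Mathlib's `ChartedSpace.comp` of the atlas of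
`M` with the one-chart atlas `{φ.symm}` of `N` over `M`). [folklore] -/
@[reducible] def Homeomorph.transportChartedSpace (φ : M ≃ₜ N) : ChartedSpace H N :=
  letI : ChartedSpace M N := φ.symm.toOpenPartialHomeomorph.singletonChartedSpace rfl
  ChartedSpace.comp H M N

/-- The preferred chart of the transported structure at `p` is `φ.symm ≫ chartAt (φ.symm p)`.
[folklore] -/
theorem Homeomorph.transportChartedSpace_chartAt (φ : M ≃ₜ N) (p : N) :
    (letI := Homeomorph.transportChartedSpace (H := H) φ; chartAt H p) =
      φ.symm.toOpenPartialHomeomorph ≫ₕ chartAt H (φ.symm p) :=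
  rfl

/-- The charts of the transported structure are the `φ.symm ≫ c`, `c` a chart of `M`.
[folklore] -/
theorem Homeomorph.mem_atlas_transportChartedSpace_iff (φ : M ≃ₜ N)
    {e : OpenPartialHomeomorph N H} :
    e ∈ (letI := Homeomorph.transportChartedSpace (H := H) φ; atlas H N) ↔
      ∃ c ∈ atlas H M, φ.symm.toOpenPartialHomeomorph ≫ₕ c = e := by
  change e ∈ image2 OpenPartialHomeomorph.trans {φ.symm.toOpenPartialHomeomorph} (atlas H M) ↔ _
  rw [image2_singleton_left]
  rfl

/-- `φ.symm ≫ c` is a chart of the transported structure for every chart `c` of `M`.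
[folklore] -/
theorem Homeomorph.trans_mem_atlas_transportChartedSpace (φ : M ≃ₜ N)
    {c : OpenPartialHomeomorph M H} (hc : c ∈ atlas H M) :
    φ.symm.toOpenPartialHomeomorph ≫ₕ c ∈
      (letI := Homeomorph.transportChartedSpace (H := H) φ; atlas H N) :=
  (Homeomorph.mem_atlas_transportChartedSpace_iff (H := H) φ).2 ⟨c, hc, rfl⟩

/-- `φ.symm.symm ≫ φ.symm = refl` as open partial homeomorphisms. [folklore] -/
theorem Homeomorph.toOpenPartialHomeomorph_symm_symm_trans (φ : M ≃ₜ N) :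
    φ.symm.toOpenPartialHomeomorph.symm ≫ₕ φ.symm.toOpenPartialHomeomorph =
      OpenPartialHomeomorph.refl M := by
  rw [← Homeomorph.symm_toOpenPartialHomeomorph, Homeomorph.symm_symm,
    ← Homeomorph.trans_toOpenPartialHomeomorph, Homeomorph.self_trans_symm,
    Homeomorph.refl_toOpenPartialHomeomorph]

/-- **Structure groupoids are transported**: if the atlas of `M` is a `G`-atlas, so is the
transported atlas of `N` (the transition map of `φ.symm ≫ c` and `φ.symm ≫ c'` is that of `c` and
`c'`). [folklore] -/
theorem Homeomorph.hasGroupoid_transportChartedSpace (φ : M ≃ₜ N) (G : StructureGroupoid H)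
    [HasGroupoid M G] : @HasGroupoid H _ N _ (Homeomorph.transportChartedSpace (H := H) φ) G := by
  letI := Homeomorph.transportChartedSpace (H := H) φ
  refine ⟨fun {e e'} he he' => ?_⟩
  obtain ⟨c, hc, rfl⟩ := (Homeomorph.mem_atlas_transportChartedSpace_iff (H := H) φ).1 he
  obtain ⟨c', hc', rfl⟩ := (Homeomorph.mem_atlas_transportChartedSpace_iff (H := H) φ).1 he'
  rw [OpenPartialHomeomorph.trans_symm_eq_symm_trans_symm, OpenPartialHomeomorph.trans_assoc,
    ← OpenPartialHomeomorph.trans_assoc _ (φ.symm.toOpenPartialHomeomorph) c',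
    Homeomorph.toOpenPartialHomeomorph_symm_symm_trans φ, OpenPartialHomeomorph.refl_trans]
  exact HasGroupoid.compatible hc hc'

end TransportChartedSpace

section TransportManifold

variable {𝕜 : Type*} [NontriviallyNormedField 𝕜] {E : Type*} [NormedAddCommGroup E]
  [NormedSpace 𝕜 E] {H : Type*} [TopologicalSpace H] {I₀ : ModelWithCorners 𝕜 E H}
  {n : WithTop ℕ∞} {M : Type*} [TopologicalSpace M] [ChartedSpace H M]
  {N : Type*} [TopologicalSpace N]

/-- **`C^n` structures are transported along homeomorphisms**: with the transported atlas, `N`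
is a `C^n` manifold whenever `M` is. [folklore] -/
theorem Homeomorph.isManifold_transportChartedSpace (φ : M ≃ₜ N) [IsManifold I₀ n M] :
    @IsManifold 𝕜 _ E _ _ H _ I₀ n N _ (Homeomorph.transportChartedSpace (H := H) φ) := by
  letI := Homeomorph.transportChartedSpace (H := H) φ
  haveI := Homeomorph.hasGroupoid_transportChartedSpace φ (contDiffGroupoid n I₀)
  exact IsManifold.mk' I₀ n N

omit [ChartedSpace H M] in
/-- The map `φ` read in the charts `c` (of `M`) and `φ.symm ≫ c` (of `N`): both `φ` and `φ.symm`
read `(c.extend I₀) ∘ (c.extend I₀).symm`, the identity on the target. [folklore] -/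
theorem Homeomorph.extend_trans_comp_eq (φ : M ≃ₜ N) (c : OpenPartialHomeomorph M H) :
    (φ.symm.toOpenPartialHomeomorph ≫ₕ c).extend I₀ ∘ φ ∘ (c.extend I₀).symm =
      fun y => c.extend I₀ ((c.extend I₀).symm y) := by
  funext y
  simp

omit [ChartedSpace H M] in
/-- The inverse map read in the charts `φ.symm ≫ c` and `c`. [folklore] -/
theorem Homeomorph.extend_comp_symm_comp_eq (φ : M ≃ₜ N) (c : OpenPartialHomeomorph M H) :
    c.extend I₀ ∘ φ.symm ∘ ((φ.symm.toOpenPartialHomeomorph ≫ₕ c).extend I₀).symm =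
      fun y => c.extend I₀ ((c.extend I₀).symm y) := by
  funext y
  simp

omit [ChartedSpace H M] in
/-- `(c.extend I₀) ∘ (c.extend I₀).symm` is `C^n` within `range I₀` at the image of every point of
the chart domain. [folklore] -/
theorem contDiffWithinAt_extend_comp_extend_symm (c : OpenPartialHomeomorph M H) {x : M}
    (hx : x ∈ c.source) :
    ContDiffWithinAt 𝕜 n (fun y => c.extend I₀ ((c.extend I₀).symm y)) (range I₀)
      (c.extend I₀ x) := by
  have hmem : (c.extend I₀).target ∈ 𝓝[range I₀] c.extend I₀ x :=
    c.extend_target_mem_nhdsWithin hx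
  refine contDiffWithinAt_id.congr_of_eventuallyEq
    (Filter.eventuallyEq_of_mem hmem fun y hy => (c.extend I₀).right_inv hy) ?_
  exact (c.extend I₀).right_inv ((c.extend I₀).map_source (by rwa [c.extend_source]))

/-- **The transporting homeomorphism is `C^n`** for the transported structure. [folklore] -/
theorem Homeomorph.contMDiff_transportChartedSpace (φ : M ≃ₜ N) [IsManifold I₀ n M] :
    letI := Homeomorph.transportChartedSpace (H := H) φ; ContMDiff I₀ I₀ n φ := by
  letI := Homeomorph.transportChartedSpace (H := H) φ
  haveI := Homeomorph.isManifold_transportChartedSpace (I₀ := I₀) (n := n) φ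
  intro x
  have hc : chartAt H x ∈ IsManifold.maximalAtlas I₀ n M := IsManifold.chart_mem_maximalAtlas x
  have hc' : φ.symm.toOpenPartialHomeomorph ≫ₕ chartAt H x ∈ IsManifold.maximalAtlas I₀ n N :=
    IsManifold.subset_maximalAtlas
      (Homeomorph.trans_mem_atlas_transportChartedSpace (H := H) φ (chart_mem_atlas H x))
  rw [contMDiffAt_iff_of_mem_maximalAtlas hc hc' (mem_chart_source H x) (by simp)]
  refine ⟨φ.continuous.continuousAt, ?_⟩
  rw [Homeomorph.extend_trans_comp_eq (I₀ := I₀) φ]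
  exact contDiffWithinAt_extend_comp_extend_symm _ (mem_chart_source H x)

/-- **The inverse of the transporting homeomorphism is `C^n`**. [folklore] -/
theorem Homeomorph.contMDiff_symm_transportChartedSpace (φ : M ≃ₜ N) [IsManifold I₀ n M] :
    letI := Homeomorph.transportChartedSpace (H := H) φ; ContMDiff I₀ I₀ n φ.symm := by
  letI := Homeomorph.transportChartedSpace (H := H) φ
  haveI := Homeomorph.isManifold_transportChartedSpace (I₀ := I₀) (n := n) φ
  intro p
  have hc : chartAt H (φ.symm p) ∈ IsManifold.maximalAtlas I₀ n M :=
    IsManifold.chart_mem_maximalAtlas (φ.symm p)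
  have hc' : φ.symm.toOpenPartialHomeomorph ≫ₕ chartAt H (φ.symm p) ∈
      IsManifold.maximalAtlas I₀ n N :=
    IsManifold.subset_maximalAtlas
      (Homeomorph.trans_mem_atlas_transportChartedSpace (H := H) φ
        (chart_mem_atlas H (φ.symm p)))
  rw [contMDiffAt_iff_of_mem_maximalAtlas hc' hc (by simp) (mem_chart_source H (φ.symm p))]
  refine ⟨φ.symm.continuous.continuousAt, ?_⟩
  rw [Homeomorph.extend_comp_symm_comp_eq (I₀ := I₀) φ]
  have : (φ.symm.toOpenPartialHomeomorph ≫ₕ chartAt H (φ.symm p)).extend I₀ p =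
      (chartAt H (φ.symm p)).extend I₀ (φ.symm p) := by simp
  rw [this]
  exact contDiffWithinAt_extend_comp_extend_symm _ (mem_chart_source H (φ.symm p))

/-- **Transport of structure along a homeomorphism, as a diffeomorphism** `M ≃ₘ^n⟮I₀, I₀⟯ N` for the
transported `C^n` structure on `N`. [folklore] -/
def Homeomorph.transportDiffeomorph (φ : M ≃ₜ N) [IsManifold I₀ n M] :
    @Diffeomorph 𝕜 _ E _ _ E _ _ H _ H _ I₀ I₀ M _ _ N _
      (Homeomorph.transportChartedSpace (H := H) φ) n :=
  letI := Homeomorph.transportChartedSpace (H := H) φ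
  { toEquiv := φ.toEquiv
    contMDiff_toFun := Homeomorph.contMDiff_transportChartedSpace φ
    contMDiff_invFun := Homeomorph.contMDiff_symm_transportChartedSpace φ }

/-- The transport diffeomorphism is `φ` as a map. [folklore] -/
theorem Homeomorph.coe_transportDiffeomorph (φ : M ≃ₜ N) [IsManifold I₀ n M] :
    letI := Homeomorph.transportChartedSpace (H := H) φ;
    ⇑(Homeomorph.transportDiffeomorph (I₀ := I₀) (n := n) φ) = φ := rfl

end TransportManifold


/-! ### Universe lift of the target fact -/

section Universe

universe u

variable {EX HX : Type*} [NormedAddCommGroup EX] [NormedSpace ℝ EX] [TopologicalSpace HX]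
  {IX : ModelWithCorners ℝ EX HX} {X : Type*} [TopologicalSpace X] [ChartedSpace HX X]
  {HX' : Type*} [TopologicalSpace HX'] {IX' : ModelWithCorners ℝ EX HX'} {X' : Type*}
  [TopologicalSpace X'] [ChartedSpace HX' X'] {K : TwoKnot}

/-- **A Gluck twist is small**: `X` is covered by the images of the two `Type`-valued pieces
`S⁴ ∖ K(S²)` and `S² × ℝ²`, so `X : Type u` is `Small.{0}`. [folklore] -/
theorem IsGluckTwist.small (h : IsGluckTwist IX X K) : Small.{0} X := by
  obtain ⟨ν, jA, jB, -, -, -, -, hU, -⟩ := h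
  refine small_of_surjective (f := Sum.elim jA jB) fun x => ?_
  rcases (show x ∈ range jA ∪ range jB by rw [hU]; exact mem_univ x) with ⟨a, rfl⟩ | ⟨b, rfl⟩
  exacts [⟨Sum.inl a, rfl⟩, ⟨Sum.inr b, rfl⟩]

/-- **Gluck twists are transported along diffeomorphisms** between manifolds with boundaryless
models (post-compose the two gluing embeddings; `IsOpenGluing.diffeomorph_comp_of_boundaryless`,
`ConnectedSumTransportProofs.lean`; Kosinski, *Differential Manifolds*, VI.1). [folklore] -/
theorem IsGluckTwist.of_diffeomorph [IX.Boundaryless] [IX'.Boundaryless] [IsManifold IX' ∞ X']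
    (h : IsGluckTwist IX X K) (e : X ≃ₘ⟮IX, IX'⟯ X') : IsGluckTwist IX' X' K := by
  obtain ⟨ν, hν⟩ := h
  exact ⟨ν, hν.diffeomorph_comp_of_boundaryless e⟩

/-- **Universe lift.** The target fact at universe `0` implies it at every universe `u`: a Gluck
twist `X : Type u` is small (`IsGluckTwist.small`), so `Shrink.{0} X : Type` is a homeomorphic copy
(`Shrink.homeomorph`); the `C^∞` structure is transported along this homeomorphism
(`Homeomorph.transportChartedSpace`, `Homeomorph.isManifold_transportChartedSpace`), which becomes a
diffeomorphism (`Homeomorph.transportDiffeomorph`), so `Shrink.{0} X` is again a Gluck twist along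
`K` (`IsGluckTwist.of_diffeomorph`), hence homeomorphic to `S⁴`, and so is `X`. [folklore] -/
theorem nonempty_homeomorph_sphere_of_isGluckTwist_of_univ_zero
    (h0 : nonempty_homeomorph_sphere_of_isGluckTwist.{0} (K := K)) :
    nonempty_homeomorph_sphere_of_isGluckTwist.{u} (K := K) := by
  intro X _ _ _ _ _ hX
  haveI : Small.{0} X := hX.small
  let φ : X ≃ₜ Shrink.{0} X := Shrink.homeomorph X
  letI : ChartedSpace (𝔼 4) (Shrink.{0} X) := Homeomorph.transportChartedSpace φ
  haveI : IsManifold (𝓡 4) ∞ (Shrink.{0} X) :=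
    Homeomorph.isManifold_transportChartedSpace (I₀ := 𝓡 4) (n := ∞) φ
  haveI : T2Space (Shrink.{0} X) := φ.t2Space
  haveI : SecondCountableTopology (Shrink.{0} X) := φ.symm.secondCountableTopology
  have h' : IsGluckTwist (𝓡 4) (Shrink.{0} X) K :=
    hX.of_diffeomorph (Homeomorph.transportDiffeomorph (I₀ := 𝓡 4) (n := ∞) φ)
  obtain ⟨e⟩ := h0 h'
  exact ⟨φ.trans e⟩

/-- **The target fact from textbook facts, at every universe.** For every 2-knot `K`, the named
fact `nonempty_homeomorph_sphere_of_isGluckTwist.{u}` (`Σ_K ≃ₜ S⁴` for every Gluck twist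
`Σ_K : Type u` of `S⁴` along `K`; Gluck 1962, §17 with Freedman 1982, Thm. 1.6) follows from:
excision and Mayer–Vietoris exactness for singular homology, the homology of spheres,
`H̃_*(Sⁿ ∖ h(Sᵏ))` (Hatcher Prop. 2B.1(b)), the `π₁`/`H₂` characterisation of homotopy 4-spheres
(`SPC4.nonempty_homotopyEquiv_sphere_four_iff.{0}`) and Freedman's theorem
(`SPC4.nonempty_homeomorph_sphere_four.{0}`), all at universe `0`: compactness
(`GluckTwistProofs.lean`), simple connectivity (this file) and `H₂ = 0`
(`GluckTwistHomology.lean`, universe `0`) are proved, and the conclusion is lifted to universe `u`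
by `nonempty_homeomorph_sphere_of_isGluckTwist_of_univ_zero`.
[cite: GluckTAMS1962, §17] [cite: FreedmanJDG1982, Thm. 1.6] -/
theorem nonempty_homeomorph_sphere_of_isGluckTwist_of_textbook_facts
    (hexc : ∀ (T : Type) [TopologicalSpace T],
      Literature.AlgebraicTopology.SingularHomology.relativeSingularHomology.isIso_map_of_interior_union_interior ℤ ℤ T)
    (h₂ : ∀ (T : Type) [TopologicalSpace T] (U V : Set T), Literature.AlgebraicTopology.SingularHomology.mayerVietoris.exact₂ ℤ ℤ U V)
    (h₃ : ∀ (T : Type) [TopologicalSpace T] (U V : Set T), Literature.AlgebraicTopology.SingularHomology.mayerVietoris.exact₃ ℤ ℤ U V)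
    (hS : Literature.AlgebraicTopology.SingularHomology.isZero_singularHomology_sphere ℤ ℤ)
    (h2B1 : isZero_singularHomology_sphere_compl_sphere)
    (hS10 : FourManifolds.nonempty_homotopyEquiv_sphere_four_iff.{0})
    (hF : FourManifolds.nonempty_homeomorph_sphere_four.{0}) :
    nonempty_homeomorph_sphere_of_isGluckTwist.{u} (K := K) :=
  nonempty_homeomorph_sphere_of_isGluckTwist_of_univ_zero
    (nonempty_homeomorph_sphere_of_isGluckTwist_of_homology
      (isZero_singularHomologyZ_two_of_isGluckTwist_of_mayerVietoris hexc h₂ h₃ hS h2B1) hS10 hF)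

end Universe

end Literature.Topology.FourManifolds

end
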